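import Summits.BirchSwinnertonDyer.BirchSwinnertonDyer.Theorems.SmallImageMuTransferMuTransferX9LocalTowerUnramified
import Summits.BirchSwinnertonDyer.BirchSwinnertonDyer.Theorems.SmallImageMuTransferMuTransferX9LocalTransverseValue
import Literature.NumberTheory.EllipticCurves.KummerSelmerStructure
import HarnessLib

/-!
# K6 crux `MuTransferX9` (stmt-BirchSwinnertonDyer-19276), CORE-PLAN S4.3 on the genuine objects, file 1/5:
# cocycle-level tools — `H¹` of equivariant coordinate maps, stability of transverse / unramified classes,
# and UNRAMIFIED COCYCLES WITH PRESCRIBED FROBENIUS VALUE (`H¹_ur ≅ N/(Fr − 1)N` with the value exposed)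

Cell `bsd-smallim`, seat `bsd-smallim-koly` gen 8 (route `SmallImageMuTransfer`, rung K6, leaf
`Rank1Residual.BSDpOnClassX9`). HONEST FRAMING: TOOL theorems; no definition, no named fact, no `sorry`;
nothing is asserted about any curve and nothing is booked. Serves the registered stub `stub_stepsTwoFourX9`
of crux 19276 (skeleton v5 bbfcbeb8eb041500; the q-TERM of MU-TRANSFER-PROOF §5 STEP 4 = Lemma 1 (iii))
and credits nothing toward its closure (`--supports … --as helper`). PARTITION (D-0054): X9 (A4) ×
p ∈ {5, 7} · X10b∧¬Surj (A5) × p = 3 (everything is stated for an odd prime / any number field) — helper;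
closes NONE.

## Content (generic: any field `F`, resp. any non-archimedean local field `F`)
* `exists_contIntertwiningMap_of_comm` — an additive map commuting with the actions is an intertwining map.
* `map_iterate_oneCocycleClass`, `map_map_eq_self_of_leftInverse` — `H¹(f)` on explicit cocycles.
* `map_mem_transverseSubgroup`, `iterate_map_mem_transverseSubgroup`, `map_mem_unramifiedSubgroup'` —
  `H¹(f)` preserves `L`-transverse and unramified classes (`res ∘ H¹(f) = H¹(f|) ∘ res`).
* `exists_unramified_cocycle_apply_frob_eq` — for a finite unramified `N` and an arithmetic Frobenius
  `Fr`, EVERY `f ∈ N` is `ψ(Fr)` for a cocycle `ψ` vanishing on inertia (Rubin PCMI 1.4.13 (1),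
  surjectivity of `H¹_ur → N/(Fr−1)N`, by x9's injectivity + the count `#H¹_ur = #N^Γ`);
  `oneCocycleClass_eq_of_unramified_of_apply_frob_sub_mem` — and such classes are determined by the
  value modulo `(Fr − 1)N`.
* small algebra: `iterate_map_add'`, `iterate_map_zero'`, `val_add_nsmul`, `map_val_nsmul_eq_mul`.

References: K. Rubin, *Euler systems and Kolyvagin systems*, PCMI 18 (2011) Prop. 1.4.13 [Rubin2011];
B. Mazur, K. Rubin, Mem. AMS 799 (2004) Lemma 1.2.1, Def. 1.1.6 [MazurRubin2004]; J. S. Milne,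
*Arithmetic Duality Theorems* (2006) I §2 [MilneADT2006].
-/

set_option linter.dupNamespace false
set_option autoImplicit false

noncomputable section

open scoped Classical ContRepresentation

universe u

namespace Summit.BirchSwinnertonDyer.BirchSwinnertonDyer.Rank1Residual.LocalSplitPrime

open CategoryTheory ContinuousCohomology Function Field ValuativeRel NumberField IsDedekindDomain Finset
open Literature.NumberTheory.GaloisRepresentations
open Literature.NumberTheory.GaloisRepresentations.IsNonarchimedeanLocalField
open _root_.TopRep
open Literature.NumberTheory.GaloisCohomology
open Literature.NumberTheory.EllipticCurves
open Summit.BirchSwinnertonDyer.Rank1Residual.GaloisImage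
open Summit.BirchSwinnertonDyer.Rank1Residual (X11b.LocBridge.mem_unramifiedSubgroup_one_iff_forall_eq_zero)

/-! ## §1 Generic local lemmas: equivariant coordinate maps on `H¹`, transverse/unramified stability -/

section Generic

variable {F : Type u} [Field F] {M₁ M₂ : Type u} [AddCommGroup M₁] [TopologicalSpace M₁]
  [DiscreteTopology M₁] [AddCommGroup M₂] [TopologicalSpace M₂] [DiscreteTopology M₂]
  (ρ₁ : DiscreteGaloisModule F M₁) (ρ₂ : DiscreteGaloisModule F M₂)

/-- An additive map commuting with the Galois actions is (the underlying map of) a continuous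
intertwining map of discrete Galois modules. [folklore] -/
theorem exists_contIntertwiningMap_of_comm (f : M₁ →+ M₂)
    (hf : ∀ (g : absoluteGaloisGroup F) (x : M₁), f (ρ₁ g x) = ρ₂ g (f x)) :
    ∃ fI : ρ₁.toContRepresentation →ⁱL ρ₂.toContRepresentation, ∀ x, fI x = f x := by
  refine ⟨{ toContinuousLinearMap :=
              { toFun := f
                map_add' := map_add f
                map_smul' := fun c x => by rw [map_zsmul, RingHom.id_apply]
                cont := continuous_of_discreteTopology }
            isIntertwining' := fun g => ContinuousLinearMap.ext fun x => hf g x }, fun x => rfl⟩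

/-- `H¹(f)` iterated on an explicit cocycle: `(H¹(f))^[i] [φ] = [f^[i] ∘ φ]`. [folklore] -/
theorem map_iterate_oneCocycleClass (fI : ρ₁.toContRepresentation →ⁱL ρ₁.toContRepresentation)
    (i : ℕ) (φ : contOneCocycles ρ₁.toTopRep) :
    ∃ ψ : contOneCocycles ρ₁.toTopRep, (∀ g, ψ.1 g = (fun x => fI x)^[i] (φ.1 g)) ∧
      (galoisCohomology.map fI 1)^[i] (oneCocycleClass ρ₁.toTopRep φ) = oneCocycleClass ρ₁.toTopRep ψ := by
  induction i with
  | zero => exact ⟨φ, fun g => rfl, rfl⟩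
  | succ i ih =>
    obtain ⟨ψ, hψ, hmap⟩ := ih
    obtain ⟨ψ', hψ', hmap'⟩ := galoisCohomology_map_oneCocycleClass ρ₁ ρ₁ fI ψ
    refine ⟨ψ', fun g => ?_, ?_⟩
    · rw [hψ', hψ, Function.iterate_succ_apply']
    · rw [Function.iterate_succ_apply', hmap, hmap']

/-- **Intertwining maps preserve `L`-transverse classes** (`res_L ∘ H¹(f) = H¹(f|_L) ∘ res_L`).
[cite: MazurRubin2004, Def. 1.1.6] -/
theorem map_mem_transverseSubgroup (L : Type u) [Field L] [Algebra F L]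
    (fI : ρ₁.toContRepresentation →ⁱL ρ₂.toContRepresentation) {c : galoisCohomology ρ₁ 1}
    (hc : c ∈ DiscreteGaloisModule.transverseSubgroup ρ₁ L) :
    galoisCohomology.map fI 1 c ∈ DiscreteGaloisModule.transverseSubgroup ρ₂ L := by
  rw [DiscreteGaloisModule.mem_transverseSubgroup_iff] at hc ⊢
  rw [galoisCohomology.res_map_one, hc, map_zero]

/-- **Intertwining maps preserve unramified classes** (x9 `X11b.Levels.map_mem_unramifiedSubgroup`,
restated to keep the import list short). [cite: MilneADT2006, Ch. I §2] -/
theorem map_mem_unramifiedSubgroup' [ValuativeRel F]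
    (fI : ρ₁.toContRepresentation →ⁱL ρ₂.toContRepresentation) {c : galoisCohomology ρ₁ 1}
    (hc : c ∈ DiscreteGaloisModule.unramifiedSubgroup ρ₁ 1) :
    galoisCohomology.map fI 1 c ∈ DiscreteGaloisModule.unramifiedSubgroup ρ₂ 1 := by
  rw [DiscreteGaloisModule.mem_unramifiedSubgroup_iff] at hc ⊢
  rw [galoisCohomology.res_map_one, hc, map_zero]

/-- `H¹(f) ∘ H¹(g) = id` when `f ∘ g = id` pointwise. [folklore] -/
theorem map_map_eq_self_of_leftInverse (fI : ρ₁.toContRepresentation →ⁱL ρ₂.toContRepresentation)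
    (gI : ρ₂.toContRepresentation →ⁱL ρ₁.toContRepresentation) (hfg : ∀ y, fI (gI y) = y)
    (c : galoisCohomology ρ₂ 1) : galoisCohomology.map fI 1 (galoisCohomology.map gI 1 c) = c := by
  obtain ⟨ψ, rfl⟩ := oneCocycleClass_surjective ρ₂.toTopRep c
  obtain ⟨ψ₁, h₁, e₁⟩ := galoisCohomology_map_oneCocycleClass ρ₂ ρ₁ gI ψ
  obtain ⟨ψ₂, h₂, e₂⟩ := galoisCohomology_map_oneCocycleClass ρ₁ ρ₂ fI ψ₁
  rw [e₁, e₂]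
  congr 1
  exact Subtype.ext (ContinuousMap.ext fun g => by rw [h₂, h₁, hfg])

/-- Iterates of `H¹(f)` preserve `L`-transverse classes. [cite: MazurRubin2004, Def. 1.1.6] -/
theorem iterate_map_mem_transverseSubgroup (L : Type u) [Field L] [Algebra F L]
    (fI : ρ₁.toContRepresentation →ⁱL ρ₁.toContRepresentation) (i : ℕ) {c : galoisCohomology ρ₁ 1}
    (hc : c ∈ DiscreteGaloisModule.transverseSubgroup ρ₁ L) :
    (galoisCohomology.map fI 1)^[i] c ∈ DiscreteGaloisModule.transverseSubgroup ρ₁ L := by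
  induction i with
  | zero => exact hc
  | succ i ih => rw [Function.iterate_succ_apply']; exact map_mem_transverseSubgroup ρ₁ ρ₁ L fI ih

/-- Iterates of an additive map are additive. [folklore] -/
theorem iterate_map_add' {A : Type*} [AddCommGroup A] (f : A →+ A) (i : ℕ) (a b : A) :
    (⇑f)^[i] (a + b) = (⇑f)^[i] a + (⇑f)^[i] b := by
  induction i with
  | zero => rfl
  | succ i ih => rw [Function.iterate_succ_apply', Function.iterate_succ_apply',
      Function.iterate_succ_apply', ih, map_add]

/-- Iterates of an additive map kill `0`. [folklore] -/
theorem iterate_map_zero' {A : Type*} [AddCommGroup A] (f : A →+ A) (i : ℕ) : (⇑f)^[i] (0 : A) = 0 := by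
  induction i with
  | zero => rfl
  | succ i ih => rw [Function.iterate_succ_apply', ih, map_zero]

/-- `((c₁ + c₂).val)•a = c₁.val•a + c₂.val•a` on a `p`-torsion element (`ZMod.val` is additive modulo
`p`). [folklore] -/
theorem val_add_nsmul {n : ℕ} [NeZero n] {A : Type*} [AddCommMonoid A] {a : A} (ha : n • a = 0)
    (c₁ c₂ : ZMod n) : (c₁ + c₂).val • a = c₁.val • a + c₂.val • a := by
  rw [ZMod.val_add, ← add_nsmul]
  set y := c₁.val + c₂.val
  conv_rhs => rw [← Nat.mod_add_div y n, add_nsmul, mul_nsmul, ha, nsmul_zero, add_zero]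

/-- `ι (c.val • ζ) = c * ι ζ` for an additive map into `ZMod n`. [folklore] -/
theorem map_val_nsmul_eq_mul {n : ℕ} [NeZero n] {A : Type*} [AddCommMonoid A] (ι : A →+ ZMod n)
    (c : ZMod n) (ζ : A) : ι (c.val • ζ) = c * ι ζ := by
  rw [map_nsmul, nsmul_eq_mul, ZMod.natCast_zmod_val]

end Generic

/-! ## §2 Unramified cocycles with prescribed Frobenius value -/

section UnramifiedValue

variable {F : Type u} [Field F] [ValuativeRel F] [TopologicalSpace F] [IsNonarchimedeanLocalField F]
  {N : Type u} [AddCommGroup N] [TopologicalSpace N] [DiscreteTopology N] [Finite N]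
  (ρF : DiscreteGaloisModule F N)

/-- **Every value is the Frobenius value of an unramified cocycle** (Rubin PCMI Prop. 1.4.13 (1),
`H¹_ur(F, N) ≅ N/(Fr − 1)N` by evaluation at `Fr`, surjectivity — with the value EXPOSED): for a
finite unramified `N`, an arithmetic Frobenius `Fr` and any `f ∈ N` there is a continuous cocycle `ψ`
vanishing on the inertia group with `ψ(Fr) = f`. [cite: Rubin2011, Prop. 1.4.13 (1) (p. 9)]
[cite: MazurRubin2004, Lemma 1.2.1 (i) (p. 10)] -/
theorem exists_unramified_cocycle_apply_frob_eq (hI : ∀ τ ∈ absInertia F, ρF τ = 1)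
    {Fr : absoluteGaloisGroup F} (hFr : IsAbsArithFrob Fr) (f : N) :
    ∃ ψ : contOneCocycles ρF.toTopRep, (∀ τ ∈ absInertia F, ψ.1 τ = 0) ∧ ψ.1 Fr = f := by
  classical
  have hI' : ∀ τ ∈ absInertia F, ∀ w : N, ρF τ w = w := fun τ hτ w => by
    rw [hI τ hτ, Module.End.one_apply]
  set δ : N →+ N := (ρF Fr : N →ₗ[ℤ] N).toAddMonoidHom - AddMonoidHom.id N with hδ
  set R : AddSubgroup N := δ.range with hR
  -- evaluation at `Fr` modulo `(Fr − 1)N`, descended to `H¹`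
  let fev : contOneCocycles ρF.toTopRep →+ N ⧸ R :=
    { toFun := fun z => QuotientAddGroup.mk (z.1 Fr)
      map_zero' := by simp
      map_add' := fun z w => by rw [Submodule.coe_add, ContinuousMap.add_apply, QuotientAddGroup.mk_add] }
  have hfev : ∀ z, fev z = QuotientAddGroup.mk (z.1 Fr) := fun _ => rfl
  obtain ⟨ev, hev⟩ := FSComp.exists_lift_of_oneCocycles ρF fev (fun z hz => by
    obtain ⟨v, hv⟩ := (oneCocycleClass_eq_zero_iff _ z).mp hz
    rw [hfev, QuotientAddGroup.eq_zero_iff, hv Fr]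
    exact ⟨v, rfl⟩)
  -- restricted to `H¹_ur` it is injective
  let eU : DiscreteGaloisModule.unramifiedSubgroup ρF 1 → N ⧸ R := fun x => ev x.1
  have hinj : Function.Injective eU := by
    intro x y hxy
    have hsub : ev ((x - y : DiscreteGaloisModule.unramifiedSubgroup ρF 1) : galoisCohomology ρF 1) = 0 := by
      rw [AddSubgroup.coe_sub, map_sub, sub_eq_zero]; exact hxy
    obtain ⟨z, hz⟩ := oneCocycleClass_surjective ρF.toTopRep (x - y).1
    have hzur : oneCocycleClass ρF.toTopRep z ∈ DiscreteGaloisModule.unramifiedSubgroup ρF 1 := by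
      rw [hz]; exact (x - y).2
    have hz0 : ∀ τ ∈ absInertia F, z.1 τ = 0 :=
      (X11b.LocBridge.mem_unramifiedSubgroup_one_iff_forall_eq_zero ρF hI' z).mp hzur
    rw [← hz, hev, hfev, QuotientAddGroup.eq_zero_iff] at hsub
    obtain ⟨m, hm⟩ := hsub
    have hm' : z.1 Fr = ρF Fr m - m := by
      rw [← hm, hδ, AddMonoidHom.sub_apply, LinearMap.toAddMonoidHom_coe, AddMonoidHom.id_apply]
    have hcl := FSComp.oneCocycleClass_eq_zero_of_apply_frob_eq ρF hI hFr z hz0 hm'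
    rw [hz] at hcl
    exact sub_eq_zero.mp (Subtype.ext hcl)
  -- counting: `#H¹_ur = #N^{Γ} = #ker δ = #N/R`
  have hcard : Nat.card (DiscreteGaloisModule.unramifiedSubgroup ρF 1) = Nat.card (N ⧸ R) := by
    rw [natCard_unramifiedSubgroup_eq_natCard_invariants ρF hI', hR,
      ← natCard_ker_eq_natCard_quotient_range]
    refine Nat.card_congr (Equiv.subtypeEquivRight fun m => ?_)
    change (∀ g : absoluteGaloisGroup F, ρF g m = m) ↔ m ∈ δ.ker
    rw [AddMonoidHom.mem_ker, hδ, AddMonoidHom.sub_apply, LinearMap.toAddMonoidHom_coe,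
      AddMonoidHom.id_apply, sub_eq_zero]
    exact ⟨fun h => h Fr, fun h g => FSComp.forall_apply_eq_of_frob_apply_eq ρF hI hFr h g⟩
  haveI : Finite (N ⧸ R) := inferInstance
  have hbij : Function.Bijective eU := (Nat.bijective_iff_injective_and_card eU).mpr ⟨hinj, hcard⟩
  -- a preimage of `f mod R`, corrected by a coboundary
  obtain ⟨x, hx⟩ := hbij.2 (QuotientAddGroup.mk f)
  obtain ⟨z, hz⟩ := oneCocycleClass_surjective ρF.toTopRep x.1
  have hzur : oneCocycleClass ρF.toTopRep z ∈ DiscreteGaloisModule.unramifiedSubgroup ρF 1 := by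
    rw [hz]; exact x.2
  have hz0 : ∀ τ ∈ absInertia F, z.1 τ = 0 :=
    (X11b.LocBridge.mem_unramifiedSubgroup_one_iff_forall_eq_zero ρF hI' z).mp hzur
  have hval : (QuotientAddGroup.mk (z.1 Fr) : N ⧸ R) = QuotientAddGroup.mk f := by
    rw [← hfev, ← hev, hz]; exact hx
  rw [QuotientAddGroup.eq] at hval
  obtain ⟨m, hm⟩ := hval
  refine ⟨z + coboundaryCocycle ρF m, fun τ hτ => ?_, ?_⟩
  · rw [Submodule.coe_add, ContinuousMap.add_apply, coboundaryCocycle_apply, hz0 τ hτ, hI τ hτ,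
      Module.End.one_apply, sub_self, add_zero]
  · rw [Submodule.coe_add, ContinuousMap.add_apply, coboundaryCocycle_apply]
    have : ρF Fr m - m = δ m := by
      rw [hδ, AddMonoidHom.sub_apply, LinearMap.toAddMonoidHom_coe, AddMonoidHom.id_apply]
    rw [this, hm, ← add_assoc, add_neg_cancel, zero_add]

/-- **Unramified cocycles with congruent Frobenius values are cohomologous** (Rubin PCMI
Prop. 1.4.13 (1), injectivity): `ψ₁(Fr) − ψ₂(Fr) ∈ (Fr − 1)N ⟹ [ψ₁] = [ψ₂]`.
[cite: Rubin2011, Prop. 1.4.13 (1) (p. 9)] -/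
theorem oneCocycleClass_eq_of_unramified_of_apply_frob_sub_mem (hI : ∀ τ ∈ absInertia F, ρF τ = 1)
    {Fr : absoluteGaloisGroup F} (hFr : IsAbsArithFrob Fr) (ψ₁ ψ₂ : contOneCocycles ρF.toTopRep)
    (h₁ : ∀ τ ∈ absInertia F, ψ₁.1 τ = 0) (h₂ : ∀ τ ∈ absInertia F, ψ₂.1 τ = 0)
    {m : N} (hm : ψ₁.1 Fr - ψ₂.1 Fr = ρF Fr m - m) :
    oneCocycleClass ρF.toTopRep ψ₁ = oneCocycleClass ρF.toTopRep ψ₂ := by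
  rw [← sub_eq_zero, ← oneCocycleClass_sub]
  refine FSComp.oneCocycleClass_eq_zero_of_apply_frob_eq ρF hI hFr (ψ₁ - ψ₂) (fun τ hτ => ?_) ?_ (m := m)
  · rw [Submodule.coe_sub, ContinuousMap.sub_apply, h₁ τ hτ, h₂ τ hτ, sub_zero]
  · rw [Submodule.coe_sub, ContinuousMap.sub_apply, hm]

end UnramifiedValue

end Summit.BirchSwinnertonDyer.BirchSwinnertonDyer.Rank1Residual.LocalSplitPrime

end
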